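import Summits.CriticalPhenomena.PercolationContinuityZ3.Theorems.PercNearOneGluingNoHeavyLowerTailSahiOneStepFibreF3CheckSound
import Summits.CriticalPhenomena.PercolationContinuityZ3.Theorems.PercNearOneGluingNoHeavyLowerTailSahiOneStepFibreF3CheckLeFour
import Summits.CriticalPhenomena.PercolationContinuityZ3.Theorems.PercNearOneGluingNoHeavyLowerTailSahiOneStepFibreF3CheckFiveD0
import Summits.CriticalPhenomena.PercolationContinuityZ3.Theorems.PercNearOneGluingNoHeavyLowerTailSahiOneStepFibreF3CheckFiveD1
import Summits.CriticalPhenomena.PercolationContinuityZ3.Theorems.PercNearOneGluingNoHeavyLowerTailSahiOneStepFibreF3CheckFiveD2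
import Summits.CriticalPhenomena.PercolationContinuityZ3.Theorems.PercNearOneGluingNoHeavyLowerTailSahiOneStepFibreF3CheckFiveD3
import Summits.CriticalPhenomena.PercolationContinuityZ3.Theorems.PercNearOneGluingNoHeavyLowerTailSahiOneStepFibreF3CheckFiveD4
import Summits.CriticalPhenomena.PercolationContinuityZ3.Theorems.PercNearOneGluingNoHeavyLowerTailSahiOneStepFibreF3CheckFiveD5
import Summits.CriticalPhenomena.PercolationContinuityZ3.Theorems.PercNearOneGluingNoHeavyLowerTailSahiOneStepFibreF3Transport
import Summits.CriticalPhenomena.PercolationContinuityZ3.Theorems.PercNearOneGluingNoHeavyLowerTailSahiOneStepFibreThresholdFive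
import HarnessLib

/-!
# One-step scheme: KAHN C5 / SAHI C₃ FOR EVERY THRESHOLD FIRST SLOT ON AT MOST FIVE COORDINATES — in particular `maj₅`

Support file (prover prim-ineq-prove-3 gen 16; `--supports stmt-CriticalPhenomena-4575`; memo
`run/shared/lean/prim/prim-ineq-prove-3/FINDING-G16-FIBRE-MAJ5.md` §0, §3.8).  No definitions, no named facts, no sorries; this file has no `native_decide`
of its own but DEPENDS on the computational files `…FibreF3CheckLeFour`, `…FibreF3CheckFiveD0…D5` (kernel axioms of `native_decide` there).

Assembly of the `(2′)` half of the one-step hypotheses for `H = Th_t(F)`, `|F| ≤ 5`: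
`osN_threshold_nonneg_of_f3` (`…F3Reduce`: fibre criterion + cone lemma) ← `f3sum_upper_nonneg_of_nat` (`…F3Transport`: relabel the free
coordinates by `range d1 ⊔ Ico d1 (d1+d2)`) ← `f3sum_upper_nonneg_nat_real` (`…F3CheckSound`: completeness of `upMasks`, soundness of the checker)
← the checks (`…F3CheckLeFour`, `…F3CheckFiveD*`).  With the `(3′)` half `osMp_threshold_nonneg_of_card_le_five` (`…FibreThresholdFive`) and the
one-step scheme `sahiE3_nonneg_of_ind` (`…SahiOneStepCone`):

**`sahiE3_threshold_nonneg_of_card_le_five`: for every finite type `ι`, every `p : ι → [0,1]`, every `F` with `|F| ≤ 5`, every `t` and ALL increasing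
`A, B ⊆ 2^ι`, `E₃(Th_t(F), A, B) ≥ 0` under `⊗Ber(pᵢ)`** — Kahn's C5 / Sahi's C₃ with first slot any threshold function of at most five coordinates;
`sahiE3_majority_five_nonneg` is the case `maj₅` (`|F| = 5`, `t = 3`), a non-canalyzing slot not covered by any earlier theorem of the tree.
-/

noncomputable section

namespace Summit.CriticalPhenomena.PercolationContinuityZ3.Theorems

namespace SahiOneStep

open MeasureTheory Finset
open Literature.Probability.Percolation (DeterminedBy)
open Literature.Probability.LatticeModels (prodBernoulli sahiE3)
open Literature.Probability.Percolation.DecisionTree (ind)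
open scoped Classical

/-- The five-coordinate checks, pointwise in `d1`. -/
theorem checkFive_eq_true {d1 θ : ℕ} (hd1 : d1 ≤ 5) (h1 : 1 ≤ θ) (h2 : θ ≤ 5) : checkFive d1 θ = true := by
  have hθ : θ ∈ Finset.range 6 := Finset.mem_range.2 (by omega)
  interval_cases d1
  · exact checkFive_d0 θ hθ h1
  · exact checkFive_d1 θ hθ h1
  · exact checkFive_d2 θ hθ h1
  · exact checkFive_d3 θ hθ h1
  · exact checkFive_d4 θ hθ h1
  · exact checkFive_d5 θ hθ h1

variable {ι : Type*} [Fintype ι] [DecidableEq ι]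

omit [Fintype ι] in
/-- **The three-copy fibre forms on at most five free coordinates are nonnegative on all pairs of upper families** (any index type). [this work] -/
theorem f3sum_upper_nonneg_of_card_le_five (D₁ D₂ : Finset ι) (hdisj : Disjoint D₁ D₂) (hcard : D₁.card + D₂.card ≤ 5) (θ : ℕ)
    (U V : Finset (Finset ι)) (hU : U ⊆ (D₁ ∪ D₂).powerset) (hUup : ∀ S ∈ U, ∀ T ∈ (D₁ ∪ D₂).powerset, S ⊆ T → T ∈ U)
    (hV : V ⊆ (D₁ ∪ D₂).powerset) (hVup : ∀ S ∈ V, ∀ T ∈ (D₁ ∪ D₂).powerset, S ⊆ T → T ∈ V) :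
    (0 : ℝ) ≤ f3sum ℝ D₁ D₂ θ (fun S => if S ∈ U then 1 else 0) (fun S => if S ∈ V then 1 else 0) :=
  f3sum_upper_nonneg_of_nat D₁ D₂ hdisj θ
    (fun U' V' hU' hU'up hV' hV'up => f3sum_upper_nonneg_nat_real hcard θ (fun hd h1 h2 => checkSlow_eq_true hd h1 h2)
      (fun _ h1 h2 => checkFive_eq_true (by omega) h1 h2) U' V' hU' hU'up hV' hV'up)
    U V hU hUup hV hVup

/-- **`(2′)` for every threshold slot on at most five coordinates**: `μ(HA)μ(HB) + (1−μH)μ(HAB) + μ(H)μ(A)μ(B) ≥ μ(HA)μ(B) + μ(HB)μ(A)` for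
`H = Th_t(F)`, `|F| ≤ 5`, all `t`, all product measures and all increasing `F`-determined `A, B`. [this work] -/
theorem osN_threshold_nonneg_of_card_le_five (p : ι → unitInterval) (F : Finset ι) (hF : F.card ≤ 5) (t : ℕ) {A B : Set (Set ι)}
    (hA : IsUpperSet A) (hB : IsUpperSet B) (hAF : DeterminedBy A (↑F : Set ι)) (hBF : DeterminedBy B (↑F : Set ι)) :
    0 ≤ osN p {ω : Set ι | t ≤ (F.filter (· ∈ ω)).card} (ind A) (ind B) := by
  refine osN_threshold_nonneg_of_f3 p F t hA hB hAF hBF fun D₁ D₂ hDF hdisj θ U V hU hUup hV hVup => ?_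
  have hcard : D₁.card + D₂.card ≤ 5 := by
    rw [← Finset.card_union_of_disjoint hdisj]
    exact (Finset.card_le_card hDF).trans hF
  exact f3sum_upper_nonneg_of_card_le_five D₁ D₂ hdisj hcard θ U V hU hUup hV hVup

/-- **KAHN C5 / SAHI C₃ FOR THRESHOLD FIRST SLOTS ON AT MOST FIVE COORDINATES.**  For every finite `ι`, `p : ι → [0,1]`, finset `F` with `|F| ≤ 5`,
threshold `t` and ALL increasing `A, B ⊆ 2^ι`: `E₃(Th_t(F), A, B) ≥ 0` under the product Bernoulli measure. [this work] -/
theorem sahiE3_threshold_nonneg_of_card_le_five (p : ι → unitInterval) (F : Finset ι) (hF : F.card ≤ 5) (t : ℕ) {A B : Set (Set ι)}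
    (hA : IsUpperSet A) (hB : IsUpperSet B) :
    0 ≤ sahiE3 (prodBernoulli p) {ω : Set ι | t ≤ (F.filter (· ∈ ω)).card} A B :=
  sahiE3_nonneg_of_ind p (determinedBy_threshold F t)
    (fun _ _ hA' hB' hAF hBF => osMp_threshold_nonneg_of_card_le_five p F hF t hA' hB' hAF hBF)
    (fun _ _ hA' hB' hAF hBF => osN_threshold_nonneg_of_card_le_five p F hF t hA' hB' hAF hBF) hA hB

/-- **KAHN C5 / SAHI C₃ FOR THE MAJORITY OF FIVE**: first slot `maj₅ = {ω | 3 ≤ #(F ∩ ω)}`, `|F| = 5`, the other two slots arbitrary increasing events.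
[this work] -/
theorem sahiE3_majority_five_nonneg (p : ι → unitInterval) (F : Finset ι) (hF : F.card = 5) {A B : Set (Set ι)}
    (hA : IsUpperSet A) (hB : IsUpperSet B) :
    0 ≤ sahiE3 (prodBernoulli p) {ω : Set ι | 3 ≤ (F.filter (· ∈ ω)).card} A B :=
  sahiE3_threshold_nonneg_of_card_le_five p F hF.le 3 hA hB

end SahiOneStep

end Summit.CriticalPhenomena.PercolationContinuityZ3.Theorems
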